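import Summits.BirchSwinnertonDyer.Rank1Residual.Supersingular.SignedRankOneCorA5
import Summits.BirchSwinnertonDyer.Rank1Residual.Supersingular.RankOneRem13RecordShapesCount
import Summits.BirchSwinnertonDyer.Rank1Residual.Supersingular.MazurTateCertificates
import HarnessLib

/-!
# Route `SignedLowerHalves`, crux `KobayashiLowerHalfLargeImage` (item stmt-BirchSwinnertonDyer-19001), its
# RANK-ONE window cells PER PAIR from ONE two-engine Mazur–Tate certificate: the record SHAPES «literal model
# + `λ(θ_n) = deg ω_n^± + 1` ⇒ Kobayashi's ± main conjecture AT THE PAIR ⇒ the crux's conclusion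
# `∃ ε, KobayashiLowerDivisibility W p ε` AT THE PAIR, and `BSD(E,p)` through BKO 2024 Cor. A.5»
# (cell `bsd-ssimc`, seat `bsd-ssimc-k3-c3` gen 5; a `--supports … --as helper` file; closes nothing about the crux)

PARTITION (cell bsd-ssimc): X7 (A7) × the `r_an = 1 ∧ surj(p) ∧ a_p = 0` window cells that carry a two-engine TIGHT
Mazur–Tate row (`λ(θ_n) = q_n + 1`, `μ(θ_n) = 0`; tree `Supersingular/MazurTateRecordsBWX7RankOne{A…M}.lean`,
`MazurTateRecordsX7Three.lean`: 306 of the 1 184 rank-one A7 cells of the planner's table, 272 of them at tier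
`flag:KOB13`) — closes PER PAIR only (through the records that instantiate these shapes; OFFERS, the desk books);
types the object of item 3's rank-one window at the crux's OWN level (the signed main conjecture at the pair); crux 3
(`Summit.BirchSwinnertonDyer.BirchSwinnertonDyer.Theses.SignedLowerHalves.KobayashiLowerHalfLargeImage`) stays OPEN
(closed BY NAME only modulo the Fouquet–Wan PRE binder, p431969). HONEST FRAMING: BSD is not proved by any of
this; nothing here is new mathematics; THEOREMS ONLY (no definition, no named fact, no `sorry`); PER PAIR, never a
class theorem.

## What this file does

Cell `b2b-bsdres` built the whole road and never instantiated it per pair: `kobayashiMainConjecture_neg_one/one_of_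
mazurTate_of_analyticRank_eq_one` (`SqueezeCertificates.lean`: at a rank-one pair with `p` odd good, `a_p = 0`,
`ρ̄_{E,p}` onto, Kobayashi 2003 Thm. 1.2 (`h12`) and Thm. 4.1 (`h41`, integral under `p`-adic surjectivity — Serre /
Wuthrich 2014 Lemma 20 `hL20`), the period-unit facts (`h5`, `h3`), GZK (`hGZK`) and ONE Mazur–Tate certificate —
`Θ ∈ Λ` with `ι Θ = θ_n(f₀)` for the newform `f₀` of level `N_E`, `Θ ≠ 0`, `μ(Θ) = 0`, `λ(Θ) = deg ω_n^± + 1`,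
`(−1)^n = ε` — force `Char X^ε(E/ℚ_∞) = (ϖ · L_p^ε)`: Kato's divisibility `ξ ∣ L^ε`, control `T ∣ ξ`, and
`(μ, λ)(L^ε) = (0, 1)` read off the certificate (`lam_signed_neg_one/one_eq_of_mazurTate'`, Pollack 2003 Prop.
6.9/6.10) squeeze `(ξ) = (L^ε)`), and `X7.bsdp_of_mazurTate_odd/even_of_corA5_of_analyticRank_eq_one`
(`SignedRankOneCorA5.lean`: then `BSD(E,p)` by Burungale–Kobayashi–Ota 2024 Cor. A.5 `hA5` — the route's own
`PublishedSignedInputs` conjunct — and Wuthrich/modularity `hmod`). The 991 `flag:KOB13` rank-one A7 cells of the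
window all ride instead `bsdp_x7r1_<label>_p`, CONDITIONAL on harvest-1's COMPOSED binder
`Kobayashi2013.rem13_padicValRat_bsd_rank_one_le_of_kato` (tier D). This file supplies the glue READ OFF A LITERAL
MODEL `⟨a₁,…,a₆⟩` exactly as `X7RankOne.bsdp_of_rem13_of_countPoints_of_surj_of_shaAn_unit` does (bounded
Kraus/Silverman minimality `hB`/`hmin`, `p ∤ Δ`, the schema point count `countPoints [a₁,…,a₆] p = p + 1`, i.e.
`a_p = 0` on the nose, an additive prime `q ∣ (Δ, c₄)` for class X7), with the `λ(Θ) < pⁿ` binder of the road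
discharged (`lam_lt_of_mazurTate`), and three conclusions per parity of the layer `n`:
* `RankOne.kobayashiMainConjecture_neg_one/one_of_mazurTate_of_countPoints` — `KobayashiMainConjecture W p ε`
  AT THE PAIR (any class with good supersingular `p`, `a_p = 0`; minimality as the instance hypothesis the
  conclusion's own statement needs);
* `RankOne.exists_kobayashiLowerDivisibility_of_mazurTate_odd/even_of_countPoints` — the CRUX'S CONCLUSION
  `∃ ε, KobayashiLowerDivisibility W p ε` AT THE PAIR (`kobayashiLowerDivisibility_of_mainConjecture`, `h = 1`);
* `X7RankOne.bsdp_of_mazurTate_odd/even_of_corA5_of_countPoints` — `BSDp W p` AT THE PAIR on class X7, every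
  input other than the certificate and the data binders (`hsurj`, `hr`, `hf₀`) a PUBLISHED named fact; NO PRE/OPEN
  binder; NO `rem13`.
The per-pair records live in `…KobayashiLowerHalfLargeImageMazurTateRecords<k>.lean`.

References: [Kobayashi2003] Thm. 1.2, Thm. 4.1, Thm. 7.4, Conjecture (p. 2), (3.6); [Pollack2003] Def. 6.15, Prop.
6.9, 6.10, 6.18; [BurungaleKobayashiOta2023] App. A Cor. A.5; [Wuthrich2014] Lemma 20, Prop. 21; [GreenbergVatsal2000]
p. 4; [SilvermanAEC2009] VII.1 Rem. 1.1, VII.5 Prop. 5.1, VIII.8; [Kraus1989] Prop. 1–2; [Miller2011LMS] Def. 1.1.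
-/

set_option autoImplicit false
set_option linter.dupNamespace false

noncomputable section

open scoped Classical MatrixGroups ModularForm

open CongruenceSubgroup WeierstrassCurve Literature.NumberTheory.EllipticCurves
  Literature.NumberTheory.EllipticCurves.ModularForms
  Literature.NumberTheory.EllipticCurves.Rank1Residual
  Literature.NumberTheory.EllipticCurves.Rank1Residual.Typed
  Literature.NumberTheory.EllipticCurves.Rank1Residual.X11RankOneCertificates
  Literature.NumberTheory.EllipticCurves.Kobayashi2003
  Literature.NumberTheory.EllipticCurves.BurungaleKobayashiOta2024 ZpExtension
  Summit.BirchSwinnertonDyer.Rank1Residual.X1.MuLambda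
  Summit.BirchSwinnertonDyer.BirchSwinnertonDyer.Rank1Residual.IntModel
  Summit.BirchSwinnertonDyer.BirchSwinnertonDyer.Rank1Residual.X11RankOne
  Summit.BirchSwinnertonDyer.Rank1Residual.X11b
  Summit.BirchSwinnertonDyer.Rank1Residual.Supersingular

namespace Summit.BirchSwinnertonDyer.BirchSwinnertonDyer.Theorems

/-! ### Kobayashi's ± main conjecture AT THE PAIR from a literal model and one Mazur–Tate certificate -/

/-- **RECORD SHAPE — `KobayashiMainConjecture W p (−1)` AT A RANK-ONE PAIR (sign `ε = −1`, the tree's `L⁺`,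
odd layer), literal model.** Inputs by name: Kobayashi 2003 Thm. 1.2 (`h12`) and Thm. 4.1 (`h41`), the period-unit
facts (`h5`, `h3`), Wuthrich 2014 Lemma 20 (`hL20`), GZK (`hGZK`); of the literal model `⟨a₁,…,a₆⟩`: it is an
elliptic, globally minimal curve (the instance hypotheses the conclusion's statement itself needs), `p ∤ Δ` and
`#Ẽ(𝔽_p) = p + 1` (`hpΔ`, `hc`: good supersingular with `a_p = 0` exactly, `IntModel.frobeniusTrace_eq`); per pair:
`ρ̄_{E,p}` onto (`hsurj`), `r_an = 1` (`hr`), and the Mazur–Tate certificate for the newform `f₀` of level `N_E`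
(`hf₀`; `Θ` with `ι Θ = θ_n(f₀)`, `n` odd, `Θ ≠ 0`, `μ(Θ) = 0`, `λ(Θ) = deg ω_n^+ + 1`; `λ(Θ) < pⁿ` is automatic,
`lam_lt_of_mazurTate`). Conclusion = `kobayashiMainConjecture_neg_one_of_mazurTate_of_analyticRank_eq_one` on the
literal model. Per pair; nothing booked; not a class theorem. [cite: Kobayashi2003, Thm. 1.2, Thm. 4.1 and Conjecture (p. 2)]
[cite: Pollack2003, Def. 6.15, Prop. 6.9, 6.10 and 6.18] [cite: Wuthrich2014, Lemma 20 (p. 399)]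
[cite: SilvermanAEC2009, VII.5 Prop. 5.1(a)] -/
theorem RankOne.kobayashiMainConjecture_neg_one_of_mazurTate_of_countPoints (p : ℕ) [Fact p.Prime]
    (h12 : Kobayashi2003.thm12_signedSelmerDual_finite_torsion)
    (h41 : Kobayashi2003.thm41_signedCharIdeal_divisibility)
    (h5 : realPeriodRat_eq_unit_mul_plusPeriod) (h3 : realPeriodRat_eq_unit_mul_plusPeriod_three)
    (hL20 : Wuthrich2014.lemma20_surjective_threeAdic_of_semistable)
    (hGZK : rank_eq_analyticRank_of_analyticRank_le_one)
    (a1 a2 a3 a4 a6 : ℤ) [(⟨a1, a2, a3, a4, a6⟩ : WeierstrassCurve ℚ).IsElliptic]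
    [(⟨a1, a2, a3, a4, a6⟩ : WeierstrassCurve ℚ).IsGloballyMinimal] (hp2 : p ≠ 2)
    (hpΔ : ¬ (p : ℤ) ∣ discOf [a1, a2, a3, a4, a6]) (hc : countPoints [a1, a2, a3, a4, a6] p = (p + 1 : ℕ))
    (hsurj : Surj (⟨a1, a2, a3, a4, a6⟩ : WeierstrassCurve ℚ) p)
    (hr : (⟨a1, a2, a3, a4, a6⟩ : WeierstrassCurve ℚ).analyticRank = 1)
    [NeZero ((⟨a1, a2, a3, a4, a6⟩ : WeierstrassCurve ℚ).conductorNorm ℤ)]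
    {f₀ : CuspForm (Gamma0 ((⟨a1, a2, a3, a4, a6⟩ : WeierstrassCurve ℚ).conductorNorm ℤ)) 2}
    (hf₀ : IsNewformOf (⟨a1, a2, a3, a4, a6⟩ : WeierstrassCurve ℚ) f₀)
    {n : ℕ} (hn : Odd n) {Θ : IwasawaAlgebra p}
    (hΘ : iwasawaToPowerSeries p Θ =
      ((mazurTateElement f₀ p n).map (algebraMap ℚ ℚ_[p]) : PowerSeries ℚ_[p]))
    (hΘ0 : Θ ≠ 0) (hμ : mu Θ = 0) (hlam : lam Θ = (cyclotomicOmegaPlus p n).natDegree + 1) :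
    KobayashiMainConjecture (⟨a1, a2, a3, a4, a6⟩ : WeierstrassCurve ℚ) p (-1) := by
  have hI : integralModelInt (⟨a1, a2, a3, a4, a6⟩ : WeierstrassCurve ℚ) = ⟨a1, a2, a3, a4, a6⟩ :=
    integralModelInt_eq_of_map_eq _ (map_mk_int a1 a2 a3 a4 a6)
  have hn' := natCard_point_eq_of_countPoints a1 a2 a3 a4 a6 p hp2 hpΔ hc
  have hSS : GoodSS (⟨a1, a2, a3, a4, a6⟩ : WeierstrassCurve ℚ) p :=
    goodSS_of_intModel p hI (by rw [intCurve_Δ]; exact hpΔ) hn' (by push_cast; simp)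
  have hap : (⟨a1, a2, a3, a4, a6⟩ : WeierstrassCurve ℚ).frobeniusTrace p = 0 := by
    rw [frobeniusTrace_eq hI hn']; push_cast; ring
  exact kobayashiMainConjecture_neg_one_of_mazurTate_of_analyticRank_eq_one _ p h12 h41 h5 h3 hL20 hGZK hp2
    hSS.1 hap hsurj hr hf₀ hn hΘ hΘ0 hμ hlam (lam_lt_of_mazurTate hΘ hΘ0 hμ)

/-- **RECORD SHAPE — `KobayashiMainConjecture W p 1` AT A RANK-ONE PAIR (sign `ε = 1`, the tree's `L⁻`, even
layer), literal model**: as `RankOne.kobayashiMainConjecture_neg_one_of_mazurTate_of_countPoints` with `n` even and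
`λ(Θ) = deg ω_n^- + 1`. Per pair; nothing booked; not a class theorem. [cite: Kobayashi2003, Thm. 1.2, Thm. 4.1 and Conjecture (p. 2)]
[cite: Pollack2003, Def. 6.15, Prop. 6.9, 6.10 and 6.18] [cite: Wuthrich2014, Lemma 20 (p. 399)]
[cite: SilvermanAEC2009, VII.5 Prop. 5.1(a)] -/
theorem RankOne.kobayashiMainConjecture_one_of_mazurTate_of_countPoints (p : ℕ) [Fact p.Prime]
    (h12 : Kobayashi2003.thm12_signedSelmerDual_finite_torsion)
    (h41 : Kobayashi2003.thm41_signedCharIdeal_divisibility)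
    (h5 : realPeriodRat_eq_unit_mul_plusPeriod) (h3 : realPeriodRat_eq_unit_mul_plusPeriod_three)
    (hL20 : Wuthrich2014.lemma20_surjective_threeAdic_of_semistable)
    (hGZK : rank_eq_analyticRank_of_analyticRank_le_one)
    (a1 a2 a3 a4 a6 : ℤ) [(⟨a1, a2, a3, a4, a6⟩ : WeierstrassCurve ℚ).IsElliptic]
    [(⟨a1, a2, a3, a4, a6⟩ : WeierstrassCurve ℚ).IsGloballyMinimal] (hp2 : p ≠ 2)
    (hpΔ : ¬ (p : ℤ) ∣ discOf [a1, a2, a3, a4, a6]) (hc : countPoints [a1, a2, a3, a4, a6] p = (p + 1 : ℕ))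
    (hsurj : Surj (⟨a1, a2, a3, a4, a6⟩ : WeierstrassCurve ℚ) p)
    (hr : (⟨a1, a2, a3, a4, a6⟩ : WeierstrassCurve ℚ).analyticRank = 1)
    [NeZero ((⟨a1, a2, a3, a4, a6⟩ : WeierstrassCurve ℚ).conductorNorm ℤ)]
    {f₀ : CuspForm (Gamma0 ((⟨a1, a2, a3, a4, a6⟩ : WeierstrassCurve ℚ).conductorNorm ℤ)) 2}
    (hf₀ : IsNewformOf (⟨a1, a2, a3, a4, a6⟩ : WeierstrassCurve ℚ) f₀)
    {n : ℕ} (hn : Even n) {Θ : IwasawaAlgebra p}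
    (hΘ : iwasawaToPowerSeries p Θ =
      ((mazurTateElement f₀ p n).map (algebraMap ℚ ℚ_[p]) : PowerSeries ℚ_[p]))
    (hΘ0 : Θ ≠ 0) (hμ : mu Θ = 0) (hlam : lam Θ = (cyclotomicOmegaMinus p n).natDegree + 1) :
    KobayashiMainConjecture (⟨a1, a2, a3, a4, a6⟩ : WeierstrassCurve ℚ) p 1 := by
  have hI : integralModelInt (⟨a1, a2, a3, a4, a6⟩ : WeierstrassCurve ℚ) = ⟨a1, a2, a3, a4, a6⟩ :=
    integralModelInt_eq_of_map_eq _ (map_mk_int a1 a2 a3 a4 a6)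
  have hn' := natCard_point_eq_of_countPoints a1 a2 a3 a4 a6 p hp2 hpΔ hc
  have hSS : GoodSS (⟨a1, a2, a3, a4, a6⟩ : WeierstrassCurve ℚ) p :=
    goodSS_of_intModel p hI (by rw [intCurve_Δ]; exact hpΔ) hn' (by push_cast; simp)
  have hap : (⟨a1, a2, a3, a4, a6⟩ : WeierstrassCurve ℚ).frobeniusTrace p = 0 := by
    rw [frobeniusTrace_eq hI hn']; push_cast; ring
  exact kobayashiMainConjecture_one_of_mazurTate_of_analyticRank_eq_one _ p h12 h41 h5 h3 hL20 hGZK hp2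
    hSS.1 hap hsurj hr hf₀ hn hΘ hΘ0 hμ hlam (lam_lt_of_mazurTate hΘ hΘ0 hμ)

/-! ### The crux's conclusion AT THE PAIR -/

/-- **RECORD SHAPE — the CRUX'S CONCLUSION `∃ ε, KobayashiLowerDivisibility W p ε` AT A RANK-ONE PAIR from an
odd-layer Mazur–Tate certificate** (the Eisenstein half of the main conjecture with `h = 1`,
`kobayashiLowerDivisibility_of_mainConjecture`; witness `ε = −1`). What item 3 asks CLASS-WIDE, delivered PER
PAIR; the crux itself is untouched. [cite: Kobayashi2003, Thm. 1.2, Thm. 4.1 and Conjecture (p. 2)]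
[cite: Pollack2003, Def. 6.15, Prop. 6.9, 6.10 and 6.18] [cite: Wuthrich2014, Lemma 20 (p. 399)] -/
theorem RankOne.exists_kobayashiLowerDivisibility_of_mazurTate_odd_of_countPoints (p : ℕ) [Fact p.Prime]
    (h12 : Kobayashi2003.thm12_signedSelmerDual_finite_torsion)
    (h41 : Kobayashi2003.thm41_signedCharIdeal_divisibility)
    (h5 : realPeriodRat_eq_unit_mul_plusPeriod) (h3 : realPeriodRat_eq_unit_mul_plusPeriod_three)
    (hL20 : Wuthrich2014.lemma20_surjective_threeAdic_of_semistable)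
    (hGZK : rank_eq_analyticRank_of_analyticRank_le_one)
    (a1 a2 a3 a4 a6 : ℤ) [(⟨a1, a2, a3, a4, a6⟩ : WeierstrassCurve ℚ).IsElliptic]
    [(⟨a1, a2, a3, a4, a6⟩ : WeierstrassCurve ℚ).IsGloballyMinimal] (hp2 : p ≠ 2)
    (hpΔ : ¬ (p : ℤ) ∣ discOf [a1, a2, a3, a4, a6]) (hc : countPoints [a1, a2, a3, a4, a6] p = (p + 1 : ℕ))
    (hsurj : Surj (⟨a1, a2, a3, a4, a6⟩ : WeierstrassCurve ℚ) p)
    (hr : (⟨a1, a2, a3, a4, a6⟩ : WeierstrassCurve ℚ).analyticRank = 1)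
    [NeZero ((⟨a1, a2, a3, a4, a6⟩ : WeierstrassCurve ℚ).conductorNorm ℤ)]
    {f₀ : CuspForm (Gamma0 ((⟨a1, a2, a3, a4, a6⟩ : WeierstrassCurve ℚ).conductorNorm ℤ)) 2}
    (hf₀ : IsNewformOf (⟨a1, a2, a3, a4, a6⟩ : WeierstrassCurve ℚ) f₀)
    {n : ℕ} (hn : Odd n) {Θ : IwasawaAlgebra p}
    (hΘ : iwasawaToPowerSeries p Θ =
      ((mazurTateElement f₀ p n).map (algebraMap ℚ ℚ_[p]) : PowerSeries ℚ_[p]))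
    (hΘ0 : Θ ≠ 0) (hμ : mu Θ = 0) (hlam : lam Θ = (cyclotomicOmegaPlus p n).natDegree + 1) :
    ∃ ε : ℤˣ, KobayashiLowerDivisibility (⟨a1, a2, a3, a4, a6⟩ : WeierstrassCurve ℚ) p ε :=
  ⟨-1, kobayashiLowerDivisibility_of_mainConjecture
    (RankOne.kobayashiMainConjecture_neg_one_of_mazurTate_of_countPoints p h12 h41 h5 h3 hL20 hGZK a1 a2 a3 a4
      a6 hp2 hpΔ hc hsurj hr hf₀ hn hΘ hΘ0 hμ hlam)⟩

/-- **RECORD SHAPE — the CRUX'S CONCLUSION `∃ ε, KobayashiLowerDivisibility W p ε` AT A RANK-ONE PAIR from an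
even-layer Mazur–Tate certificate** (witness `ε = 1`). Per pair; the crux itself is untouched.
[cite: Kobayashi2003, Thm. 1.2, Thm. 4.1 and Conjecture (p. 2)] [cite: Pollack2003, Def. 6.15, Prop. 6.9, 6.10 and 6.18]
[cite: Wuthrich2014, Lemma 20 (p. 399)] -/
theorem RankOne.exists_kobayashiLowerDivisibility_of_mazurTate_even_of_countPoints (p : ℕ) [Fact p.Prime]
    (h12 : Kobayashi2003.thm12_signedSelmerDual_finite_torsion)
    (h41 : Kobayashi2003.thm41_signedCharIdeal_divisibility)
    (h5 : realPeriodRat_eq_unit_mul_plusPeriod) (h3 : realPeriodRat_eq_unit_mul_plusPeriod_three)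
    (hL20 : Wuthrich2014.lemma20_surjective_threeAdic_of_semistable)
    (hGZK : rank_eq_analyticRank_of_analyticRank_le_one)
    (a1 a2 a3 a4 a6 : ℤ) [(⟨a1, a2, a3, a4, a6⟩ : WeierstrassCurve ℚ).IsElliptic]
    [(⟨a1, a2, a3, a4, a6⟩ : WeierstrassCurve ℚ).IsGloballyMinimal] (hp2 : p ≠ 2)
    (hpΔ : ¬ (p : ℤ) ∣ discOf [a1, a2, a3, a4, a6]) (hc : countPoints [a1, a2, a3, a4, a6] p = (p + 1 : ℕ))
    (hsurj : Surj (⟨a1, a2, a3, a4, a6⟩ : WeierstrassCurve ℚ) p)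
    (hr : (⟨a1, a2, a3, a4, a6⟩ : WeierstrassCurve ℚ).analyticRank = 1)
    [NeZero ((⟨a1, a2, a3, a4, a6⟩ : WeierstrassCurve ℚ).conductorNorm ℤ)]
    {f₀ : CuspForm (Gamma0 ((⟨a1, a2, a3, a4, a6⟩ : WeierstrassCurve ℚ).conductorNorm ℤ)) 2}
    (hf₀ : IsNewformOf (⟨a1, a2, a3, a4, a6⟩ : WeierstrassCurve ℚ) f₀)
    {n : ℕ} (hn : Even n) {Θ : IwasawaAlgebra p}
    (hΘ : iwasawaToPowerSeries p Θ =
      ((mazurTateElement f₀ p n).map (algebraMap ℚ ℚ_[p]) : PowerSeries ℚ_[p]))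
    (hΘ0 : Θ ≠ 0) (hμ : mu Θ = 0) (hlam : lam Θ = (cyclotomicOmegaMinus p n).natDegree + 1) :
    ∃ ε : ℤˣ, KobayashiLowerDivisibility (⟨a1, a2, a3, a4, a6⟩ : WeierstrassCurve ℚ) p ε :=
  ⟨1, kobayashiLowerDivisibility_of_mainConjecture
    (RankOne.kobayashiMainConjecture_one_of_mazurTate_of_countPoints p h12 h41 h5 h3 hL20 hGZK a1 a2 a3 a4 a6
      hp2 hpΔ hc hsurj hr hf₀ hn hΘ hΘ0 hμ hlam)⟩

/-! ### `BSD(E,p)` AT THE PAIR on class X7, through BKO 2024 Cor. A.5 -/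

/-- **RECORD SHAPE — class X7, `BSD(E,p)` AT A RANK-ONE PAIR from an odd-layer Mazur–Tate certificate and
Burungale–Kobayashi–Ota 2024 Cor. A.5**, literal model with bounded Kraus/Silverman minimality (`hB`, `hmin`,
exactly as `X7RankOne.bsdp_of_rem13_of_countPoints_of_surj_of_shaAn_unit`), `p ∤ Δ`, `#Ẽ(𝔽_p) = p + 1` (`a_p = 0`),
an additive prime `q ∣ (Δ, c₄)` (class X7, `classX7_of_intModel`); inputs by name `h12`, `h41`, `h5`, `h3`, `hL20`,
`hGZK`, modularity `hmod`, Cor. A.5 `hA5` (PUBLISHED; referee flags `BKO24-CorA5-IMC-unpinned`,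
`BKO24-CorA5-proof-by-reference-Kob14` recorded in the fact's docstring); data binders `hsurj`, `hr`, the newform
`hf₀` and the certificate (`Θ`, `hΘ`, `hΘ0`, `hμ`, `hlam`). Conclusion =
`X7.bsdp_of_mazurTate_odd_of_corA5_of_analyticRank_eq_one` on the literal model; NO `rem13`, NO PRE/OPEN binder.
Per pair; class X7 and crux 3 unchanged; nothing booked. [cite: BurungaleKobayashiOta2023, App. A Cor. A.5]
[cite: Kobayashi2003, Thm. 7.4, Thm. 1.2, Thm. 4.1 and Conjecture (p. 2)] [cite: Pollack2003, Def. 6.15, Prop. 6.9, 6.10 and 6.18]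
[cite: Wuthrich2014, Lemma 20 (p. 399)] [cite: SilvermanAEC2009, VII.1 Remark 1.1, VII.5 Prop. 5.1 and VIII.8]
[cite: Kraus1989, Prop. 1 and Prop. 2] [cite: Miller2011LMS, §1 and Def. 1.1] -/
theorem X7RankOne.bsdp_of_mazurTate_odd_of_corA5_of_countPoints (p : ℕ) [Fact p.Prime]
    (h12 : Kobayashi2003.thm12_signedSelmerDual_finite_torsion)
    (h41 : Kobayashi2003.thm41_signedCharIdeal_divisibility)
    (h5 : realPeriodRat_eq_unit_mul_plusPeriod) (h3 : realPeriodRat_eq_unit_mul_plusPeriod_three)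
    (hL20 : Wuthrich2014.lemma20_surjective_threeAdic_of_semistable)
    (hGZK : rank_eq_analyticRank_of_analyticRank_le_one) (hmod : hasEntireLFunction_rat)
    (hA5 : corA5_pPart_of_signedCharIdeal_eq)
    (a1 a2 a3 a4 a6 : ℤ) (hp2 : p ≠ 2)
    (hB : (discOf [a1, a2, a3, a4, a6]).natAbs < 512 ^ 12)
    (hmin : ∀ q < 512, q < 2 ∨ ¬ q ^ 12 ∣ (discOf [a1, a2, a3, a4, a6]).natAbs ∨
      ¬ q ^ 4 ∣ (c4Of [a1, a2, a3, a4, a6]).natAbs ∨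
      (q = 2 ∧ ¬ (2 : ℤ) ^ 8 ∣ c4Of [a1, a2, a3, a4, a6] ∧ (2 : ℤ) ^ 7 ∣ c6Of [a1, a2, a3, a4, a6]) ∨
      (q = 2 ∧ ¬ (2 : ℤ) ^ 24 ∣ discOf [a1, a2, a3, a4, a6] ∧ (512 : ℤ) ∣ c6Of [a1, a2, a3, a4, a6] ∧
        (4 : ℤ) ∣ c6Of [a1, a2, a3, a4, a6] / 512 - 3) ∨
      (q = 3 ∧ (3 : ℤ) ^ 8 ∣ c6Of [a1, a2, a3, a4, a6] ∧ ¬ (3 : ℤ) ^ 9 ∣ c6Of [a1, a2, a3, a4, a6]))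
    (hpΔ : ¬ (p : ℤ) ∣ discOf [a1, a2, a3, a4, a6]) (hc : countPoints [a1, a2, a3, a4, a6] p = (p + 1 : ℕ))
    (q : ℕ) (hq : q.Prime) (hqΔ : (q : ℤ) ∣ discOf [a1, a2, a3, a4, a6])
    (hqc₄ : (q : ℤ) ∣ c4Of [a1, a2, a3, a4, a6])
    (hsurj : Surj (⟨a1, a2, a3, a4, a6⟩ : WeierstrassCurve ℚ) p)
    (hr : (⟨a1, a2, a3, a4, a6⟩ : WeierstrassCurve ℚ).analyticRank = 1)
    [NeZero ((⟨a1, a2, a3, a4, a6⟩ : WeierstrassCurve ℚ).conductorNorm ℤ)]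
    {f₀ : CuspForm (Gamma0 ((⟨a1, a2, a3, a4, a6⟩ : WeierstrassCurve ℚ).conductorNorm ℤ)) 2}
    (hf₀ : IsNewformOf (⟨a1, a2, a3, a4, a6⟩ : WeierstrassCurve ℚ) f₀)
    {n : ℕ} (hn : Odd n) {Θ : IwasawaAlgebra p}
    (hΘ : iwasawaToPowerSeries p Θ =
      ((mazurTateElement f₀ p n).map (algebraMap ℚ ℚ_[p]) : PowerSeries ℚ_[p]))
    (hΘ0 : Θ ≠ 0) (hμ : mu Θ = 0) (hlam : lam Θ = (cyclotomicOmegaPlus p n).natDegree + 1) :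
    BSDp (⟨a1, a2, a3, a4, a6⟩ : WeierstrassCurve ℚ) p := by
  have h0 : discOf [a1, a2, a3, a4, a6] ≠ 0 := fun h ↦ hpΔ (by rw [h]; exact dvd_zero _)
  obtain ⟨_, _, hI⟩ := integralModelInt_ainvs_of_krausCriterion_bounded a1 a2 a3 a4 a6 h0 hB hmin
  have hn' := natCard_point_eq_of_countPoints a1 a2 a3 a4 a6 p hp2 hpΔ hc
  have hX : ClassX7 (⟨a1, a2, a3, a4, a6⟩ : WeierstrassCurve ℚ) p :=
    classX7_of_intModel p hI (by rw [intCurve_Δ]; exact hpΔ) hn' (by push_cast; simp) q hq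
      (by rw [intCurve_Δ]; exact hqΔ) (by rw [intCurve_c₄]; exact hqc₄)
  have hap : (⟨a1, a2, a3, a4, a6⟩ : WeierstrassCurve ℚ).frobeniusTrace p = 0 := by
    rw [frobeniusTrace_eq hI hn']; push_cast; ring
  exact X7.bsdp_of_mazurTate_odd_of_corA5_of_analyticRank_eq_one _ p h12 h41 h5 h3 hL20 hGZK hmod hA5 hp2 hX hap
    hsurj hr hf₀ hn hΘ hΘ0 hμ hlam (lam_lt_of_mazurTate hΘ hΘ0 hμ)

/-- **RECORD SHAPE — class X7, `BSD(E,p)` AT A RANK-ONE PAIR from an even-layer Mazur–Tate certificate and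
Burungale–Kobayashi–Ota 2024 Cor. A.5** (sign `ε = 1`; `n` even, `λ(Θ) = deg ω_n^- + 1`); otherwise as
`X7RankOne.bsdp_of_mazurTate_odd_of_corA5_of_countPoints`. Per pair; nothing booked.
[cite: BurungaleKobayashiOta2023, App. A Cor. A.5] [cite: Kobayashi2003, Thm. 7.4, Thm. 1.2, Thm. 4.1 and Conjecture (p. 2)]
[cite: Pollack2003, Def. 6.15, Prop. 6.9, 6.10 and 6.18] [cite: Wuthrich2014, Lemma 20 (p. 399)]
[cite: SilvermanAEC2009, VII.1 Remark 1.1, VII.5 Prop. 5.1 and VIII.8] [cite: Kraus1989, Prop. 1 and Prop. 2]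
[cite: Miller2011LMS, §1 and Def. 1.1] -/
theorem X7RankOne.bsdp_of_mazurTate_even_of_corA5_of_countPoints (p : ℕ) [Fact p.Prime]
    (h12 : Kobayashi2003.thm12_signedSelmerDual_finite_torsion)
    (h41 : Kobayashi2003.thm41_signedCharIdeal_divisibility)
    (h5 : realPeriodRat_eq_unit_mul_plusPeriod) (h3 : realPeriodRat_eq_unit_mul_plusPeriod_three)
    (hL20 : Wuthrich2014.lemma20_surjective_threeAdic_of_semistable)
    (hGZK : rank_eq_analyticRank_of_analyticRank_le_one) (hmod : hasEntireLFunction_rat)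
    (hA5 : corA5_pPart_of_signedCharIdeal_eq)
    (a1 a2 a3 a4 a6 : ℤ) (hp2 : p ≠ 2)
    (hB : (discOf [a1, a2, a3, a4, a6]).natAbs < 512 ^ 12)
    (hmin : ∀ q < 512, q < 2 ∨ ¬ q ^ 12 ∣ (discOf [a1, a2, a3, a4, a6]).natAbs ∨
      ¬ q ^ 4 ∣ (c4Of [a1, a2, a3, a4, a6]).natAbs ∨
      (q = 2 ∧ ¬ (2 : ℤ) ^ 8 ∣ c4Of [a1, a2, a3, a4, a6] ∧ (2 : ℤ) ^ 7 ∣ c6Of [a1, a2, a3, a4, a6]) ∨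
      (q = 2 ∧ ¬ (2 : ℤ) ^ 24 ∣ discOf [a1, a2, a3, a4, a6] ∧ (512 : ℤ) ∣ c6Of [a1, a2, a3, a4, a6] ∧
        (4 : ℤ) ∣ c6Of [a1, a2, a3, a4, a6] / 512 - 3) ∨
      (q = 3 ∧ (3 : ℤ) ^ 8 ∣ c6Of [a1, a2, a3, a4, a6] ∧ ¬ (3 : ℤ) ^ 9 ∣ c6Of [a1, a2, a3, a4, a6]))
    (hpΔ : ¬ (p : ℤ) ∣ discOf [a1, a2, a3, a4, a6]) (hc : countPoints [a1, a2, a3, a4, a6] p = (p + 1 : ℕ))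
    (q : ℕ) (hq : q.Prime) (hqΔ : (q : ℤ) ∣ discOf [a1, a2, a3, a4, a6])
    (hqc₄ : (q : ℤ) ∣ c4Of [a1, a2, a3, a4, a6])
    (hsurj : Surj (⟨a1, a2, a3, a4, a6⟩ : WeierstrassCurve ℚ) p)
    (hr : (⟨a1, a2, a3, a4, a6⟩ : WeierstrassCurve ℚ).analyticRank = 1)
    [NeZero ((⟨a1, a2, a3, a4, a6⟩ : WeierstrassCurve ℚ).conductorNorm ℤ)]
    {f₀ : CuspForm (Gamma0 ((⟨a1, a2, a3, a4, a6⟩ : WeierstrassCurve ℚ).conductorNorm ℤ)) 2}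
    (hf₀ : IsNewformOf (⟨a1, a2, a3, a4, a6⟩ : WeierstrassCurve ℚ) f₀)
    {n : ℕ} (hn : Even n) {Θ : IwasawaAlgebra p}
    (hΘ : iwasawaToPowerSeries p Θ =
      ((mazurTateElement f₀ p n).map (algebraMap ℚ ℚ_[p]) : PowerSeries ℚ_[p]))
    (hΘ0 : Θ ≠ 0) (hμ : mu Θ = 0) (hlam : lam Θ = (cyclotomicOmegaMinus p n).natDegree + 1) :
    BSDp (⟨a1, a2, a3, a4, a6⟩ : WeierstrassCurve ℚ) p := by
  have h0 : discOf [a1, a2, a3, a4, a6] ≠ 0 := fun h ↦ hpΔ (by rw [h]; exact dvd_zero _)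
  obtain ⟨_, _, hI⟩ := integralModelInt_ainvs_of_krausCriterion_bounded a1 a2 a3 a4 a6 h0 hB hmin
  have hn' := natCard_point_eq_of_countPoints a1 a2 a3 a4 a6 p hp2 hpΔ hc
  have hX : ClassX7 (⟨a1, a2, a3, a4, a6⟩ : WeierstrassCurve ℚ) p :=
    classX7_of_intModel p hI (by rw [intCurve_Δ]; exact hpΔ) hn' (by push_cast; simp) q hq
      (by rw [intCurve_Δ]; exact hqΔ) (by rw [intCurve_c₄]; exact hqc₄)
  have hap : (⟨a1, a2, a3, a4, a6⟩ : WeierstrassCurve ℚ).frobeniusTrace p = 0 := by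
    rw [frobeniusTrace_eq hI hn']; push_cast; ring
  exact X7.bsdp_of_mazurTate_even_of_corA5_of_analyticRank_eq_one _ p h12 h41 h5 h3 hL20 hGZK hmod hA5 hp2 hX
    hap hsurj hr hf₀ hn hΘ hΘ0 hμ hlam (lam_lt_of_mazurTate hΘ hΘ0 hμ)

end Summit.BirchSwinnertonDyer.BirchSwinnertonDyer.Theorems

end
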